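import Summits.BirchSwinnertonDyer.BirchSwinnertonDyer.Theorems.TwoAdicConverseOrdLambdaHalfAtTwoColemanTransport
import Summits.BirchSwinnertonDyer.BirchSwinnertonDyer.Theorems.TwoAdicConverseOrdLambdaHalfAtTwoThetaDatumDefs
import Summits.BirchSwinnertonDyer.BirchSwinnertonDyer.Theorems.TwoAdicConverseOrdLambdaHalfAtTwoShapiroPTDefs
import Summits.BirchSwinnertonDyer.BirchSwinnertonDyer.Theorems.TwoAdicConverseOrdLambdaHalfAtTwoTorsionQuotOfPT
import Summits.BirchSwinnertonDyer.BirchSwinnertonDyer.Theorems.TwoAdicConverseOrdLambdaHalfAtTwoPinnedMinusSide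
import Summits.BirchSwinnertonDyer.BirchSwinnertonDyer.Theorems.ByReductionTypeAtTwoGVISeed
import Literature.NumberTheory.EllipticCurves.KatoFineSelmerDualTorsion
import Literature.NumberTheory.EllipticCurves.KatoFineSelmerDualProofs
import Literature.NumberTheory.EllipticCurves.IwasawaSelmerModuleFiniteProofs
import Literature.NumberTheory.EllipticCurves.CyclotomicZpExtensionLocalGeneratorProofs
import Literature.NumberTheory.EllipticCurves.Kato2004.IwasawaCohomologyExistsProofs
import Literature.NumberTheory.EllipticCurves.Kato2004.LocalIwasawaCohomologyFiniteness
import Literature.NumberTheory.EllipticCurves.PAdicLFunctionNeZeroHoldsProofs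
import Literature.Uncategorized.OrdPublishedInputsAtTwo
import HarnessLib

/-!
# Route `TwoAdicConverse` (rung S3), crux `OrdLambdaHalfAtTwo` (item stmt-BirchSwinnertonDyer-19556), line
# `kato_determinant_greenberg_two` (skeleton v4.7 `59b5c9c4a969`): THE REGISTERED STUB 4‴ `ThetaShapiroKatoGreenbergSupplyAtTwo`
# ASSEMBLED FROM NAMED INPUTS — `thetaShapiroKatoGreenbergSupplyAtTwo_of_inputs`

Cell `bsd-2adic`, seat `bsd-2adic-conv-1` GEN 31 (`--supports stmt-BirchSwinnertonDyer-19556 --as helper`; the LEAD closes registered stubs).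
The construction stub 4‴ (`Nonempty (ThetaShapiroKatoGreenbergDatum …)` over Kato's genuine carriers, skeleton §3) DISSOLVES into seven named
statements, every one print-grade or a displayed memo binder of the line:

| input | tier | where |
|---|---|---|
| `Literature.Uncategorized.OrdConversePublishedInputsAtTwo` | PUB (item 19167 = `stub_pub`) | Kato 17.4 at `2` ⇒ `X`, `X'` torsion |
| `Kato2004.exists_zetaClass_colemanMinus_recLaw_index_two` (p681779) | t1 named fact | zeta classes, `Col⁻`, rec laws, index identities |
| `Kato2004.tateModuleFilAt_inertia_ordinary` (p698222) | t1 named fact | ordinary-line rigidity ⇒ `recA` through W's `Col⁻` |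
| `Kato2004.localIwasawaH1_tateRep_moduleFinite` | t1 named fact ((12.2.3)) | `finiteHl` |
| `Kato2004_fineSelmerDual_isTorsion` | PUB-composite named fact | `X₀(W/ℚ_∞)`, `X₀(A/ℚ_∞)` torsion for (S) |
| `TwoAdicShapiroPT.LambdaShapiroFineAtTwo` | memo binder (S), file `…ShapiroPTDefs` (conv-1 GEN 28) | `katoIndex` (`λ`-Shapiro for the fine duals) |
| `TwoAdicShapiroPT.ShapiroLatticePoitouTateAtTwoTheta` | memo binder (PT), p688403 | `u_A`, `L`, `range_le`, `two_smul_mem`, `θ`, `δ`, `π`, `loc_injective` |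

So with this file the LEAD may replace `stub_thetaShapiroKatoGreenbergSupplyAtTwo`'s `sorry` by
`TwoAdicThetaSupply.thetaShapiroKatoGreenbergSupplyAtTwo_of_inputs stub_pub h₁ h₂ h₃ h₄ h₅ h₆` with six print/memo stubs — the line then reads
«19556|(β) ⟸ 6‴ + {PUB, FW, F3-K, ORD, (12.2.3), X₀-torsion, (S), (PT)}», every non-research input displayed by name.  (GEN 30's kernel supply of
(PT)'s lattice clauses, p695719, and the kernel `isTorsion_quot` S2, p685520, are what (PT) still packages beyond the Poitou–Tate triple.)

HONEST FRAMING.  THEOREMS ONLY; no definition, no named fact minted here, no `sorry`; CONDITIONAL on the seven named inputs; the crux `OrdLambdaHalfAtTwo`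
is NOT proved here (stub 6‴, research, is untouched); BSD is not proved by any of this.  PARTITION (D-0054): none — RANK axis S3 × X5@2 stratum (β);
closes none (the lead closes the registered stub).
-/

set_option linter.dupNamespace false
set_option autoImplicit false

noncomputable section

open scoped NumberField
open Field IsDedekindDomain WeierstrassCurve CategoryTheory
open Literature.NumberTheory.GaloisRepresentations
open Literature.NumberTheory.EllipticCurves Literature.NumberTheory.EllipticCurves.Kato2004
open Literature.NumberTheory.EllipticCurves.Kato2004.EulerSystemValues

namespace Summit.BirchSwinnertonDyer.BirchSwinnertonDyer.Theorems.TwoAdicThetaSupply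

open scoped MatrixGroups ModularForm
open CongruenceSubgroup NumberField Literature.NumberTheory.EllipticCurves.ModularForms
open Literature.NumberTheory.EllipticCurves.Rank1Residual
open Summit.BirchSwinnertonDyer.BirchSwinnertonDyer.Theorems.TwoAdicKatoDeterminant
open Summit.BirchSwinnertonDyer.BirchSwinnertonDyer.Theorems.TwoAdicShapiroPT
open Summit.BirchSwinnertonDyer.BirchSwinnertonDyer.Theorems.TwoAdicColemanTransport
open Summit.BirchSwinnertonDyer.Rank1Residual.X1.MuLambda (lam)
open Summit.BirchSwinnertonDyer.Rank1Residual.X11b (AcSelmer.bdpData AcSelmer.strictDatum)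

/-- **STUB 4‴ `ThetaShapiroKatoGreenbergSupplyAtTwo` ⟸ SEVEN NAMED INPUTS** (the registered construction stub of line `kato_determinant_greenberg_two`,
skeleton v4.7, BY NAME).  Inputs: [PUB] `OrdConversePublishedInputsAtTwo` (item 19167 = the line's `stub_pub`; only Kato 17.4 at `2` is used, for
the torsion of `X(E/ℚ_∞)`, `X(E^K/ℚ_∞)`) · [F3-K] `Kato2004.exists_zetaClass_colemanMinus_recLaw_index_two` (p681779) · [ORD]
`Kato2004.tateModuleFilAt_inertia_ordinary` (p698222) · [(12.2.3)] `Kato2004.localIwasawaH1_tateRep_moduleFinite` · [X₀] `Kato2004_fineSelmerDual_isTorsion` ·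
[(S)] `TwoAdicShapiroPT.LambdaShapiroFineAtTwo` (memo binder) · [(PT)] `TwoAdicShapiroPT.ShapiroLatticePoitouTateAtTwoTheta` (memo binder, re-keyed).
ASSEMBLY: `v = (2)`, a local lift `γᵥ` of the generator and `κ ∘ res_v` onto (tree `ZpExtension.IsCyclotomic.…`), pins
`I_W, I_A` (`nonempty_iwasawaH1Data_holds`), `J, J', J_A` (`nonempty_localIwasawaH1Data`); (PT) gives `u_A` bijective, the Shapiro lattice `L` with
`range_le` / `two_smul_mem`, `θ, θ_C, δ, π` and `loc_injective` under cotorsion; `TwoAdicColemanTransport.exists_colemanMinus_recLaws` gives the Kato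
fields incl. `recA` through W's `Col⁻`; `finiteHl` is (12.2.3); `isTorsion_quot` is the kernel theorem
`PinnedKatoCore.isTorsion_quot_of_poitouTate_semilinear` (p685520); `katoIndex` = F3-K's two `λ`-index identities + (S) + `λ(Λ⧸(L₀)) = λ(L₀)`
(`L₀ ≠ 0` by Rohrlich), with `X, X'` torsion by Kato 17.4 (`GVISeed.isTorsion_and_lambda_le_lam_of_kato`) and `X₀(W/ℚ_∞)`, `X₀(A/ℚ_∞)` f.g. torsion by
[X₀] + `FineSelmerDualData.module_finite`.  CONDITIONAL on the seven inputs; nothing else.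
[cite: Kato2004Asterisque, Thm 12.5, §17.13, Thm 16.6, Prop 17.11] [cite: GreenbergLNM1716, §2 (pp. 62–64)] [cite: GreenbergVatsal2000, §2] -/
theorem thetaShapiroKatoGreenbergSupplyAtTwo_of_inputs
    (hPub : Literature.Uncategorized.OrdConversePublishedInputsAtTwo)
    (hF3K : Kato2004.exists_zetaClass_colemanMinus_recLaw_index_two)
    (hOrd : Kato2004.tateModuleFilAt_inertia_ordinary)
    (hHl : Kato2004.localIwasawaH1_tateRep_moduleFinite)
    (hX₀ : Kato2004_fineSelmerDual_isTorsion)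
    (hS : LambdaShapiroFineAtTwo) (hPT : ShapiroLatticePoitouTateAtTwoTheta) :
    ThetaShapiroKatoGreenbergSupplyAtTwo := by
  intro W _ _ hCM hGO hβ κ γ hκ hγ hγ' hord _ f hf D L₀ hL₀ K _ _ hK A _ _ C hA hordA _ g hg DA L₀' hL₀' w hw κK γK hκK hγK
    DGr Dfi hcot _ _
  obtain ⟨-, hKato, -⟩ := hPub
  -- the place `2`, a local lift of the generator, the pins
  obtain ⟨v, hv⟩ : ∃ v : HeightOneSpectrum (𝓞 ℚ), ((2 : ℕ) : 𝓞 ℚ) ∈ v.asIdeal := by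
    -- (= tree `Literature.NumberTheory.Automorphic.exists_heightOneSpectrum_two_mem_asIdeal`, re-derived to keep the import closure small)
    have hne : Ideal.span {((2 : ℕ) : 𝓞 ℚ)} ≠ ⊤ := by
      rw [Ne, Ideal.span_singleton_eq_top]
      intro h
      have h2 : IsUnit ((2 : ℕ) : ℤ) := by
        have := h.map (Rat.IsIntegralClosure.intEquiv (𝓞 ℚ))
        rwa [map_natCast] at this
      exact absurd (Int.isUnit_iff.mp h2) (by norm_num)
    obtain ⟨M, hM, hle⟩ := Ideal.exists_le_maximal _ hne
    have hM0 : M ≠ ⊥ := by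
      intro h0
      rw [h0, le_bot_iff, Ideal.span_singleton_eq_bot] at hle
      exact two_ne_zero (by exact_mod_cast hle)
    exact ⟨⟨M, hM.isPrime, hM0⟩, hle (Ideal.mem_span_singleton_self _)⟩
  obtain ⟨γᵥ, hγᵥ⟩ := hκ.exists_isTopGenerator_resGalOfEmb_adicCompletion v hv
  have hsurj : Function.Surjective
      (κ.toContinuousMonoidHom.comp (resGalOfEmb (closureEmb (K := ℚ) (v.adicCompletion ℚ)))) := fun t ↦ by
    obtain ⟨g₀, -, hg₀⟩ := hκ.exists_mem_absInertia_apply_resGalOfEmb_adicCompletion_eq v hv t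
    exact ⟨g₀, hg₀⟩
  obtain ⟨I_W⟩ := Kato2004.nonempty_iwasawaH1Data_holds W 2 κ γ hκ hγ
  obtain ⟨I_A⟩ := Kato2004.nonempty_iwasawaH1Data_holds A 2 κ γ hκ hγ
  obtain ⟨J⟩ := nonempty_localIwasawaH1Data κ v ((tateRep W 2).toLocal v) γᵥ
  obtain ⟨J'⟩ := nonempty_localIwasawaH1Data κ v (tateLocalOrdinaryRep W 2 v) γᵥ
  obtain ⟨J_A⟩ := nonempty_localIwasawaH1Data κ v ((tateRep A 2).toLocal v) γᵥ
  have hH2 : SatisfiesHeegnerHypothesis 2 K := hK.2.of_dvd (dvd_mul_right 2 _)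
  -- (PT): the local untwisting, the Shapiro lattice, the re-keyed Poitou–Tate triple, loc-injectivity
  obtain ⟨uA, hbij, L, hle, h2L, ⟨θ, θ_C, δ, π, hδ, hπ, hex⟩, hinj⟩ :=
    hPT W K hK.1 hH2 A C hA w hw κ γ hκ hγ κK γK hκK hγK v hv γᵥ hsurj hγᵥ I_W I_A J J_A DGr Dfi
  -- Kato per curve, read on W's carrier
  obtain ⟨col, zW, zA, uW, uA', nW, nA, hker, hcoker, hrecW, hrecA, htW, htA, hidxW, hidxA⟩ :=
    exists_colemanMinus_recLaws hF3K hOrd f hf hord g hg hordA κ γ hκ hγ hγ' L₀ hL₀ L₀' hL₀' v hv γᵥ hsurj hγᵥ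
      I_W I_A J J' J_A uA hbij
  -- torsion / finiteness of the cyclotomic duals (Kato), fine duals over `ℚ_∞`
  have hL₀0 : L₀ ≠ 0 := by
    rintro rfl; exact padicLFunction_unitRoot_ne_zero hord hf (by rw [← hL₀, map_zero])
  have hL₀'0 : L₀' ≠ 0 := by
    rintro rfl; exact padicLFunction_unitRoot_ne_zero hordA hg (by rw [← hL₀', map_zero])
  have hL₀1 : iwasawaToPowerSeries 2 L₀ = PowerSeries.C ((1 : ℚ) : ℚ_[2]) * padicLFunction f (unitRoot W 2 : ℚ_[2]) := by
    rw [hL₀, Rat.cast_one, map_one, one_mul]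
  have hL₀'1 : iwasawaToPowerSeries 2 L₀' = PowerSeries.C ((1 : ℚ) : ℚ_[2]) * padicLFunction g (unitRoot A 2 : ℚ_[2]) := by
    rw [hL₀', Rat.cast_one, map_one, one_mul]
  obtain ⟨hDt, -⟩ := Summit.BirchSwinnertonDyer.BirchSwinnertonDyer.Theorems.GVISeed.isTorsion_and_lambda_le_lam_of_kato W
    (hKato W f) hκ hγ hγ' hord hf D one_ne_zero hL₀1 hL₀0
  obtain ⟨hDAt, -⟩ := Summit.BirchSwinnertonDyer.BirchSwinnertonDyer.Theorems.GVISeed.isTorsion_and_lambda_le_lam_of_kato A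
    (hKato A g) hκ hγ hγ' hordA hg DA one_ne_zero hL₀'1 hL₀'0
  have hDfin : Module.Finite (IwasawaAlgebra 2) D.X := D.module_finite_holds hγ
  have hDAfin : Module.Finite (IwasawaAlgebra 2) DA.X := DA.module_finite_holds hγ
  obtain ⟨Y_W⟩ := W.nonempty_fineSelmerDualData κ hγ
  obtain ⟨Y_A⟩ := A.nonempty_fineSelmerDualData κ hγ
  have hYW := fineSelmerDual_finite_and_isTorsion_of_kato2004 hX₀ W 2 hκ hγ Y_W
  have hYA := fineSelmerDual_finite_and_isTorsion_of_kato2004 hX₀ A 2 hκ hγ Y_A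
  -- (S)
  obtain ⟨-, hlamS⟩ := hS W K hK.1 hH2 A C hA κ γ hκ hγ κK γK hκK hγK Y_W Y_A Dfi hYW.1 hYW.2 hYA.1 hYA.2
  have hiW := hidxW D Y_W hDfin hDt
  have hiA := hidxA DA Y_A hDAfin hDAt
  have hbW := PinnedKatoGreenbergDatum.lambdaInvariant_quotient_span_singleton_eq_lam hL₀0
  have hbA := PinnedKatoGreenbergDatum.lambdaInvariant_quotient_span_singleton_eq_lam hL₀'0
  refine ⟨v, γᵥ, hsurj, hγᵥ, I_W, I_A, J, J', J_A, uA, ⟨{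
    two_mem := hv
    uA_bijective := hbij
    colMinus := col
    colMinus_ker := hker
    colMinus_coker := hcoker
    zW := zW
    zA := zA
    nW := nW
    nA := nA
    unitW := uW
    unitA := uA'
    recW := hrecW
    recA := hrecA
    finiteHl := hHl W 2 κ v γᵥ hκ hv hγᵥ J
    loc_injective := hinj hcot.1 hcot.2
    isTorsion_quot := PinnedKatoCore.isTorsion_quot_of_poitouTate_semilinear zW zA htW htA L h2L θ δ hδ hcot.2
    L := L
    range_le := hle
    two_smul_mem := h2L
    θ := θ
    θ_C := θ_C
    δ := δ
    δ_injective := hδ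
    π := π
    π_surjective := hπ
    exact_δ_π := hex
    katoIndex := ?_ }⟩⟩
  change lambdaInvariant 2 _ + lambdaInvariant 2 _ + (lambdaInvariant 2 D.X + lambdaInvariant 2 DA.X) = _
  omega

end Summit.BirchSwinnertonDyer.BirchSwinnertonDyer.Theorems.TwoAdicThetaSupply

end
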